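import Summits.SmoothPoincare4.SmoothPoincare4.Theses.RootDecompZ

/-!
# RootDecompZ — glue of the rev-2 split «GeometricStrata» of `CrossSectionQHS`

Proves the glue item `CrossSectionQHSGlue` (stmt-SmoothPoincare4-31921, support, rank 304) of
route-SmoothPoincare4-RootDecompZ rev 2:
`SolvableStratumQHS → SeifertStratumQHS → GenericStratumQHS → CrossSectionQHS`
(stmt-SmoothPoincare4-31918 → 31919 → 31920 → 30639).

Pure logic (excluded middle on «π₁ virtually solvable» and on «π₁ has an infinite cyclic normal subgroup»):
the three geometric strata of a rational-homology-sphere cross-section exhaust the parent.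
Text kernel-checked in the lens certificate HOME/decomp-sp4-lens-3/v10/GeometricStrataV10.lean §3
(`crossSectionQHS_of_strata`) and in the tribunal's scratch `Trib8.z_qhs_glue`; this file re-proves it against the
route's own declarations. Root decomposition cell decomp-sp4 (D-0178); 0 sorry. Nothing here proves `SmoothPoincare4`.
-/

set_option linter.dupNamespace false

namespace Summit.SmoothPoincare4.SmoothPoincare4.Theorems.RootDecompZCrossSectionQHSSplit

open Summit.SmoothPoincare4.SmoothPoincare4.Theses.RootDecompZ

/-- Item stmt-SmoothPoincare4-31921: the three geometric strata re-assemble the parent `CrossSectionQHS`. -/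
theorem crossSectionQHSGlue_holds : CrossSectionQHSGlue := by
  intro hSolv hSeif hGen M _ _ _ _ _ e Y _ _ _ _ _ _ _ y f hf hfin hc
  refine (Classical.em _).elim (fun h₁ => hSolv M e Y y f hf hfin hc h₁) (fun h₁ => ?_)
  exact (Classical.em _).elim (fun h₂ => hSeif M e Y y f hf hfin hc h₁ h₂) (fun h₂ => hGen M e Y y f hf hfin hc h₁ h₂)

end Summit.SmoothPoincare4.SmoothPoincare4.Theorems.RootDecompZCrossSectionQHSSplit
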